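import Mathlib
import Literature.MathematicalPhysics.QuantumFieldTheory.Balaban1983to89.SchurTest

/-! # `Balaban1983to89.B9Thm311` — the positivity argument of B9 Theorem 3.11 (p. 416), kernel-checked, and the
exact input it needs

CITATION HEADER. Supports the adversarial reading (unit `b2b-balaban-adv1`, gen 3, cell pub-balaban) of
T. Balaban, *Propagators for lattice gauge theories in a background field*, Commun. Math. Phys. 99 (1985) 389–434
[`Balaban1985BackgroundPropagators`], Theorem 3.11 (p. 416, render `…-background-propagators-p028-x2.png`):
"Under the assumptions of the Theorems 3.1–3.10 (i.e. for M sufficiently large and α₀ sufficiently small) the operators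
Δ′_a, G′, (Q′G′²Q′*)^{−1}, Δ_a, G are positive definite."  WHAT IS PRINTED (p. 416): "G … is a symmetric and invertible
operator, so if it is not positive, then there exists A₀ ≠ 0, λ₀ > 0 such that GA₀ = −λ₀A₀. By (3.106) G = G₀(I − R)^{−1},
R is an operator with small norm. Let us assume that the operator G₀ is positive, then … the quadratic form
⟨A, G₀^{1/2}(I − R)^{−1}G₀^{1/2}A⟩ = ⟨(I − R)^{−1}G₀^{1/2}A, (I − R*)(I − R)^{−1}G₀^{1/2}A⟩ assumes negative values …
This is in contradiction with the inequality Re⟨A,(I − R*)A⟩ = ⟨A,A⟩ − Re⟨A,RA⟩ ≥ (1 − O(M^{−1}))⟨A,A⟩ > 0 holding for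
M sufficiently large."  The relation (3.105) is `Δ_a G₀ = I − R`, i.e. `G₀ = G (I − R)` (p. 414); the smallness of `R`
is asserted on p. 414 as "(3.85) with O(M^{−1}) instead of O(α₁)", and (3.85) (p. 407) is the BLOCK-LOCALISED SUP bound
`|(V(A)G(U)J)(b)| ≤ O(1)α₁ e^{−½δ₀d(y,y′)}|J|` for `b ∈ Δ(y)`, `supp J ⊂ Δ(y′)`.

WHAT THIS FILE CERTIFIES (kernel):
1. `posDef_of_factor` — the abstract step is CORRECT and needs no square root: if `G` is Hermitian, `G₀` is positive
   definite, `G₀ = G (1 − R)` and `Re⟨B, RB⟩ < ⟨B, B⟩` for every `B ≠ 0`, then `G` is positive definite (finite index set,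
   any `RCLike` scalar field).  Proof: an eigenvector `v` of `G` with eigenvalue `μ ≤ 0`, `B := (1 − R)^{−1}v` (`1 − R` is
   invertible by the same smallness), gives `0 < Re⟨B, G₀B⟩ = μ (⟨B,B⟩ − Re⟨B,RB⟩) ≤ 0`.
2. `re_dot_lt_of_schur` — the smallness hypothesis of 1 in the L² sense FOLLOWS from `‖R‖_{∞→∞} ≤ ρ` AND `‖R*‖_{∞→∞} ≤ ρ`
   (row and column absolute sums of the kernel) with `ρ < 1`, through the finite Schur test of `SchurTest.sum_sq_le`
   (real scalars).
3. `supBound_not_l2` — a block-localised sup bound ALONE does not give the L² statement: the rank-one kernel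
   `T x x′ = [x′ = x₀]` on `N` sites satisfies `|(TJ)(x)| ≤ sup|J|` for every `J`, yet `‖T δ_{x₀}‖₂² = N ‖δ_{x₀}‖₂²`.
   Hence the printed sentence "R is an operator with small norm" is an `∞→∞` statement as printed and the L² form used
   in the displayed inequality needs, in addition, the `∞→∞` smallness of `R*` (or an L² walk bound of the (3.108)-type
   "corresponding inequalities", the transfer flagged in GAPS G-A1-1(a)).  GAPS row G-B9-06a records the census.
Elementary; [folklore] (spectral theorem for Hermitian matrices, Schur test). -/

namespace Literature.MathematicalPhysics.QuantumFieldTheory.Balaban1983to89.B9Thm311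

open Matrix Finset
open scoped ComplexOrder

variable {n : Type*} [Fintype n] [DecidableEq n]

section abstractStep

variable {𝕜 : Type*} [RCLike 𝕜]

/-- The smallness `Re⟨B, RB⟩ < ⟨B, B⟩` (`B ≠ 0`) makes `1 − R` invertible. [folklore] -/
theorem isUnit_one_sub_of_re_dot_lt (R : Matrix n n 𝕜)
    (hR : ∀ B : n → 𝕜, B ≠ 0 → RCLike.re (star B ⬝ᵥ (R *ᵥ B)) < RCLike.re (star B ⬝ᵥ B)) :
    IsUnit (1 - R) := by
  rw [← Matrix.mulVec_injective_iff_isUnit]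
  intro B₁ B₂ h
  by_contra hne
  have hB : B₁ - B₂ ≠ 0 := sub_ne_zero.mpr hne
  have h0 : (1 - R) *ᵥ (B₁ - B₂) = 0 := by
    rw [Matrix.mulVec_sub, h, sub_self]
  have hRB : R *ᵥ (B₁ - B₂) = B₁ - B₂ := by
    rw [Matrix.sub_mulVec, Matrix.one_mulVec] at h0
    exact (sub_eq_zero.mp h0).symm
  have := hR (B₁ - B₂) hB
  rw [hRB] at this
  exact lt_irrefl _ this

/-- **B9 Theorem 3.11, the abstract step (p. 416), without the square root.**  `G` Hermitian, `G₀` positive definite,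
`G₀ = G (1 − R)` (this is (3.105) `Δ_a G₀ = I − R` multiplied by `G = Δ_a^{−1}`), and `Re⟨B, RB⟩ < ⟨B, B⟩` for
`B ≠ 0` (the printed "(1 − O(M^{−1}))⟨A,A⟩ > 0") ⇒ `G` positive definite. [folklore] -/
theorem posDef_of_factor (G G₀ R : Matrix n n 𝕜) (hG : G.IsHermitian) (hG₀ : G₀.PosDef)
    (hfac : G₀ = G * (1 - R))
    (hR : ∀ B : n → 𝕜, B ≠ 0 → RCLike.re (star B ⬝ᵥ (R *ᵥ B)) < RCLike.re (star B ⬝ᵥ B)) :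
    G.PosDef := by
  rw [hG.posDef_iff_eigenvalues_pos]
  intro i
  by_contra hle
  rw [not_lt] at hle
  set μ : ℝ := hG.eigenvalues i with hμ
  set v : n → 𝕜 := ⇑(hG.eigenvectorBasis i) with hv
  have hGv : G *ᵥ v = (μ : 𝕜) • v := by
    have h1 := hG.mulVec_eigenvectorBasis i
    rw [RCLike.real_smul_eq_coe_smul (K := 𝕜)] at h1
    exact h1
  have hv0 : v ≠ 0 := by
    intro h
    have hnorm := (hG.eigenvectorBasis).orthonormal.1 i
    have : (hG.eigenvectorBasis i : EuclideanSpace 𝕜 n) = 0 := by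
      ext x
      have := congrFun h x
      simpa [hv] using this
    rw [this, norm_zero] at hnorm
    exact zero_ne_one hnorm
  -- `1 − R` is invertible, so `v = (1 − R) B` for some `B`
  have hunit := isUnit_one_sub_of_re_dot_lt R hR
  obtain ⟨B, hB⟩ := Matrix.mulVec_surjective_iff_isUnit.mpr hunit v
  have hB0 : B ≠ 0 := by
    rintro rfl
    rw [Matrix.mulVec_zero] at hB
    exact hv0 hB.symm
  -- `G₀ B = G (1 − R) B = G v = μ v = μ (B − R B)`
  have hG₀B : G₀ *ᵥ B = (μ : 𝕜) • (B - R *ᵥ B) := by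
    rw [hfac, ← Matrix.mulVec_mulVec, hB, hGv, ← hB, Matrix.sub_mulVec, Matrix.one_mulVec]
  have hpos := hG₀.re_dotProduct_pos hB0
  rw [hG₀B, dotProduct_smul, smul_eq_mul, RCLike.re_ofReal_mul, dotProduct_sub, map_sub] at hpos
  have hgap : 0 < RCLike.re (star B ⬝ᵥ B) - RCLike.re (star B ⬝ᵥ (R *ᵥ B)) := sub_pos.mpr (hR B hB0)
  have : μ * (RCLike.re (star B ⬝ᵥ B) - RCLike.re (star B ⬝ᵥ (R *ᵥ B))) ≤ 0 :=
    mul_nonpos_of_nonpos_of_nonneg hle hgap.le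
  linarith

end abstractStep

section schur

omit [DecidableEq n] in
/-- Cauchy–Schwarz for the real dot product. [folklore] -/
theorem dot_sq_le (x y : n → ℝ) : (x ⬝ᵥ y) ^ 2 ≤ (x ⬝ᵥ x) * (y ⬝ᵥ y) := by
  have h := Finset.sum_mul_sq_le_sq_mul_sq (univ : Finset n) x y
  simpa [dotProduct, sq] using h

omit [DecidableEq n] in
/-- **The L² smallness of `R` from `∞→∞` bounds on `R` AND on `R*`.**  If every row and every column of `|R|` sums to at
most `ρ < 1`, then `⟨B, RB⟩ < ⟨B, B⟩` for every `B ≠ 0` — the hypothesis of `posDef_of_factor` (real scalars).  The row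
sums are `‖R‖_{∞→∞}` (the printed sup smallness, (3.85) with `O(M^{−1})` summed over blocks with B6 Lemma 2.1), the
column sums are `‖R*‖_{∞→∞}` — the input NOT printed on p. 414/416. [folklore] (Schur test) -/
theorem re_dot_lt_of_schur (R : Matrix n n ℝ) {ρ : ℝ} (hρ : ρ < 1)
    (hrow : ∀ i, ∑ j, |R i j| ≤ ρ) (hcol : ∀ j, ∑ i, |R i j| ≤ ρ) :
    ∀ B : n → ℝ, B ≠ 0 → B ⬝ᵥ (R *ᵥ B) < B ⬝ᵥ B := by
  intro B hB
  have hBB : 0 < B ⬝ᵥ B := by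
    have hnn : 0 ≤ B ⬝ᵥ B := Finset.sum_nonneg fun i _ => mul_self_nonneg _
    have hne : B ⬝ᵥ B ≠ 0 := fun h => hB (dotProduct_self_eq_zero.mp h)
    exact lt_of_le_of_ne hnn (Ne.symm hne)
  have hρ0 : 0 ≤ ρ := by
    rcases isEmpty_or_nonempty n with hE | ⟨⟨i₀⟩⟩
    · exact absurd (funext fun x => (IsEmpty.false x).elim) hB
    · exact le_trans (Finset.sum_nonneg fun j _ => abs_nonneg _) (hrow i₀)
  -- Schur: ‖RB‖² ≤ ρ² ‖B‖²
  have hS : (R *ᵥ B) ⬝ᵥ (R *ᵥ B) ≤ ρ * ρ * (B ⬝ᵥ B) := by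
    have h := SchurTest.sum_sq_le (fun i j => R i j) B hrow hcol
    simpa [dotProduct, Matrix.mulVec, sq] using h
  -- Cauchy–Schwarz: ⟨B, RB⟩² ≤ ‖B‖² ‖RB‖² ≤ ρ² ‖B‖⁴
  have hcs := dot_sq_le B (R *ᵥ B)
  have hsq : (B ⬝ᵥ (R *ᵥ B)) ^ 2 ≤ (ρ * (B ⬝ᵥ B)) ^ 2 := by
    calc (B ⬝ᵥ (R *ᵥ B)) ^ 2 ≤ (B ⬝ᵥ B) * ((R *ᵥ B) ⬝ᵥ (R *ᵥ B)) := hcs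
      _ ≤ (B ⬝ᵥ B) * (ρ * ρ * (B ⬝ᵥ B)) := by gcongr
      _ = (ρ * (B ⬝ᵥ B)) ^ 2 := by ring
  have habs : B ⬝ᵥ (R *ᵥ B) ≤ ρ * (B ⬝ᵥ B) := by
    exact le_trans (le_abs_self _) (abs_le_of_sq_le_sq hsq (by positivity))
  calc B ⬝ᵥ (R *ᵥ B) ≤ ρ * (B ⬝ᵥ B) := habs
    _ < 1 * (B ⬝ᵥ B) := by gcongr
    _ = B ⬝ᵥ B := one_mul _

end schur

section witness

/-- The rank-one kernel `T x x′ = [x′ = x₀]`: `(TJ)(x) = J x₀` for every `x`. [folklore] -/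
def copyKernel (x₀ : n) : Matrix n n ℝ := fun _ x' => if x' = x₀ then 1 else 0

/-- `(copyKernel x₀ J)(x) = J x₀`. [folklore] -/
theorem copyKernel_mulVec (x₀ : n) (J : n → ℝ) (x : n) : (copyKernel x₀ *ᵥ J) x = J x₀ := by
  simp [copyKernel, Matrix.mulVec, dotProduct]

/-- **Sup bounds do not control the L² norm uniformly in the number of sites.**  For every `N`-site index set the kernel
`copyKernel x₀` satisfies the block-localised sup bound `|(TJ)(x)| ≤ sup|J|` with constant `1` for EVERY `J`, while on
`J = δ_{x₀}` (with `‖δ_{x₀}‖₂² = 1`) it has `‖TJ‖₂² = N`.  So an estimate of the shape (3.85) — a bound on `|(RJ)(b)|` by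
`sup|J|` — is not by itself an L² operator bound with the same constant; the (3.85)-type sup smallness of `R` must be
complemented by that of `R*` (`re_dot_lt_of_schur`) or by an L² bound. [folklore] -/
theorem supBound_not_l2 (x₀ : n) :
    (∀ (J : n → ℝ) (M : ℝ), (∀ x, |J x| ≤ M) → ∀ x, |(copyKernel x₀ *ᵥ J) x| ≤ M) ∧
    (∑ x, ((copyKernel x₀ *ᵥ (Pi.single x₀ (1 : ℝ) : n → ℝ)) x) ^ 2 = (Fintype.card n : ℝ)) ∧
    (∑ x, ((Pi.single x₀ (1 : ℝ) : n → ℝ) x) ^ 2 = (1 : ℝ)) := by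
  refine ⟨fun J M hM x => by rw [copyKernel_mulVec]; exact hM x₀, ?_, ?_⟩
  · simp [copyKernel_mulVec]
  · simp [Pi.single_apply]

end witness

section spectral

open scoped MatrixOrder

omit [DecidableEq n] in
/-- Row sums bound every real eigenvalue: if `∑ⱼ |R i j| ≤ ρ` for all `i` and `R w = μ w` with `w ≠ 0`, then
`|μ| ≤ ρ` (evaluate at a coordinate where `|w|` is maximal). [folklore] -/
theorem abs_eigenvalue_le_of_row_sums (R : Matrix n n ℝ) {ρ : ℝ} (hrow : ∀ i, ∑ j, |R i j| ≤ ρ)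
    (μ : ℝ) (w : n → ℝ) (hw : w ≠ 0) (hRw : R *ᵥ w = μ • w) : |μ| ≤ ρ := by
  have hne : (Finset.univ : Finset n).Nonempty := by
    rcases isEmpty_or_nonempty n with hE | hN
    · exact absurd (funext fun x => (IsEmpty.false x).elim) hw
    · exact Finset.univ_nonempty
  obtain ⟨i, -, hi⟩ := Finset.exists_max_image Finset.univ (fun i => |w i|) hne
  have hwi : 0 < |w i| := by
    by_contra h
    rw [not_lt] at h
    apply hw
    funext x
    have := hi x (Finset.mem_univ x)
    exact abs_nonpos_iff.mp (this.trans h)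
  have hrowi : |μ| * |w i| ≤ ρ * |w i| := by
    have h1 : |μ| * |w i| = |(R *ᵥ w) i| := by
      rw [hRw, Pi.smul_apply, smul_eq_mul, abs_mul]
    have h2 : |(R *ᵥ w) i| ≤ ∑ j, |R i j| * |w j| := by
      simp only [Matrix.mulVec, dotProduct]
      exact (Finset.abs_sum_le_sum_abs _ _).trans (le_of_eq (by simp [abs_mul]))
    have h3 : ∑ j, |R i j| * |w j| ≤ ∑ j, |R i j| * |w i| :=
      Finset.sum_le_sum fun j _ => mul_le_mul_of_nonneg_left (hi j (Finset.mem_univ j)) (abs_nonneg _)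
    have h4 : ∑ j, |R i j| * |w i| = (∑ j, |R i j|) * |w i| := by rw [Finset.sum_mul]
    calc |μ| * |w i| = |(R *ᵥ w) i| := h1
      _ ≤ ∑ j, |R i j| * |w j| := h2
      _ ≤ ∑ j, |R i j| * |w i| := h3
      _ = (∑ j, |R i j|) * |w i| := h4
      _ ≤ ρ * |w i| := mul_le_mul_of_nonneg_right (hrow i) (abs_nonneg _)
  exact le_of_mul_le_mul_right hrowi hwi

/-- **B9 Theorem 3.11 from the PRINTED `∞→∞` smallness alone (spectral form).**  Real scalars.  `G` symmetric, `G₀`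
positive definite, `G₀ = G (1 − R)` ((3.105)), and every REAL eigenvalue of `R` is `< 1` ⇒ `G` positive definite.  Proof
(the printed square-root argument, run on eigenvalues instead of quadratic forms): with `L = √G₀`, `T := L⁻¹ G L⁻¹` is
symmetric and congruent to `G`; a non-positive eigenvalue `μ` of `T` with eigenvector `v` gives, for `w := L⁻¹ v ≠ 0`,
`G w = μ G₀ w`, hence `w = μ (1 − R) w`, so `μ ≠ 0` and `R w = (1 − μ⁻¹) w` with `1 − μ⁻¹ > 1`.  Combined with
`abs_eigenvalue_le_of_row_sums` (`posDef_of_factor_rowSums`) this closes the positivity clause of Thm 3.11 for `G` from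
(3.105), the positivity of `G₀` and the printed sup smallness of `R` ALONE — the L² inequality displayed on p. 416 is a
detour, not a missing input. [folklore] -/
theorem posDef_of_factor_spectral (G G₀ R : Matrix n n ℝ) (hG : G.IsHermitian) (hG₀ : G₀.PosDef)
    (hfac : G₀ = G * (1 - R))
    (hR : ∀ (μ : ℝ) (w : n → ℝ), w ≠ 0 → R *ᵥ w = μ • w → μ < 1) :
    G.PosDef := by
  -- the square root `L` of `G₀`
  set L : Matrix n n ℝ := CFC.sqrt G₀ with hLdef
  have hLL : L * L = G₀ := CFC.sqrt_mul_sqrt_self G₀ hG₀.posSemidef.nonneg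
  have hLu : IsUnit L := (CFC.isUnit_sqrt_iff G₀ hG₀.posSemidef.nonneg).2 hG₀.isUnit
  have hLdet : IsUnit L.det := (Matrix.isUnit_iff_isUnit_det _).1 hLu
  have hLh : Lᴴ = L := (CFC.sqrt_nonneg G₀).isSelfAdjoint
  have hLinvh : (L⁻¹)ᴴ = L⁻¹ := by rw [Matrix.conjTranspose_nonsing_inv, hLh]
  -- `1 − R` is invertible (an eigenvalue `1` of `R` is excluded by `hR`)
  have hunit : IsUnit (1 - R) := by
    rw [← Matrix.mulVec_injective_iff_isUnit]
    intro B₁ B₂ h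
    by_contra hne
    have hB : B₁ - B₂ ≠ 0 := sub_ne_zero.mpr hne
    have h0 : (1 - R) *ᵥ (B₁ - B₂) = 0 := by rw [Matrix.mulVec_sub, h, sub_self]
    rw [Matrix.sub_mulVec, Matrix.one_mulVec, sub_eq_zero] at h0
    have := hR 1 (B₁ - B₂) hB (by rw [one_smul]; exact h0.symm)
    exact lt_irrefl _ this
  -- congruence: `G` posdef ↔ `T := L⁻¹ G L⁻¹` posdef
  set T : Matrix n n ℝ := L⁻¹ * G * L⁻¹ with hTdef
  have hLinvu : IsUnit L⁻¹ := (Matrix.isUnit_nonsing_inv_iff).2 hLu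
  have hstar : star L⁻¹ = L⁻¹ := by rw [Matrix.star_eq_conjTranspose, hLinvh]
  have hcong : T.PosDef ↔ G.PosDef := by
    have h := Matrix.IsUnit.posDef_star_right_conjugate_iff hLinvu (x := G)
    rw [hstar] at h
    exact h
  have hT : T.IsHermitian := by
    have h := Matrix.isHermitian_conjTranspose_mul_mul (L⁻¹) hG
    rw [hLinvh] at h
    exact h
  rw [← hcong, hT.posDef_iff_eigenvalues_pos]
  intro i
  by_contra hle
  rw [not_lt] at hle
  set μ : ℝ := hT.eigenvalues i with hμ
  set v : n → ℝ := ⇑(hT.eigenvectorBasis i) with hv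
  have hTv : T *ᵥ v = μ • v := hT.mulVec_eigenvectorBasis i
  have hv0 : v ≠ 0 := by
    intro h
    have hnorm := (hT.eigenvectorBasis).orthonormal.1 i
    have : (hT.eigenvectorBasis i : EuclideanSpace ℝ n) = 0 := by
      ext x
      simpa [hv] using congrFun h x
    rw [this, norm_zero] at hnorm
    exact zero_ne_one hnorm
  -- `w := L⁻¹ v`, so `v = L w` and `G w = μ G₀ w`
  set w : n → ℝ := L⁻¹ *ᵥ v with hw
  have hLw : L *ᵥ w = v := by
    rw [hw, Matrix.mulVec_mulVec, Matrix.mul_nonsing_inv _ hLdet, Matrix.one_mulVec]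
  have hw0 : w ≠ 0 := by
    intro h; apply hv0; rw [← hLw, h, Matrix.mulVec_zero]
  have e1 : L⁻¹ *ᵥ (G *ᵥ w) = μ • v := by
    have h := hTv
    rw [hTdef, ← Matrix.mulVec_mulVec, ← Matrix.mulVec_mulVec] at h
    exact h
  clear_value w
  have hGw : G *ᵥ w = μ • (G₀ *ᵥ w) := by
    calc G *ᵥ w = L *ᵥ (L⁻¹ *ᵥ (G *ᵥ w)) := by
          rw [Matrix.mulVec_mulVec _ L L⁻¹, Matrix.mul_nonsing_inv _ hLdet, Matrix.one_mulVec]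
      _ = L *ᵥ (μ • v) := by rw [e1]
      _ = μ • (L *ᵥ (L *ᵥ w)) := by rw [Matrix.mulVec_smul, hLw]
      _ = μ • (G₀ *ᵥ w) := by rw [Matrix.mulVec_mulVec, hLL]
  -- `w = (1 − R) u`, then `G₀ u = μ G₀ w`, so `u = μ w`
  obtain ⟨u, huw⟩ := Matrix.mulVec_surjective_iff_isUnit.mpr hunit w
  have hu : G₀ *ᵥ u = G₀ *ᵥ (μ • w) := by
    calc G₀ *ᵥ u = G *ᵥ ((1 - R) *ᵥ u) := by rw [Matrix.mulVec_mulVec, ← hfac]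
      _ = G *ᵥ w := by rw [huw]
      _ = μ • (G₀ *ᵥ w) := hGw
      _ = G₀ *ᵥ (μ • w) := by rw [Matrix.mulVec_smul]
  have hinj := Matrix.mulVec_injective_iff_isUnit.mpr hG₀.isUnit
  have huw' : u = μ • w := hinj hu
  have hweq : w = μ • (w - R *ᵥ w) := by
    calc w = (1 - R) *ᵥ u := huw.symm
      _ = μ • ((1 - R) *ᵥ w) := by rw [huw', Matrix.mulVec_smul]
      _ = μ • (w - R *ᵥ w) := by rw [Matrix.sub_mulVec, Matrix.one_mulVec]
  have hμ0 : μ ≠ 0 := by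
    intro h
    apply hw0
    rw [hweq, h, zero_smul]
  have hRw : R *ᵥ w = (1 - μ⁻¹) • w := by
    have h3 : μ⁻¹ • w = w - R *ᵥ w := by
      calc μ⁻¹ • w = μ⁻¹ • (μ • (w - R *ᵥ w)) := by conv_lhs => rw [hweq]
        _ = w - R *ᵥ w := by rw [smul_smul, inv_mul_cancel₀ hμ0, one_smul]
    rw [sub_smul, one_smul, h3]
    abel
  have hlt := hR (1 - μ⁻¹) w hw0 hRw
  have hinv : 0 < μ⁻¹ := by linarith
  exact absurd (inv_pos.mp hinv) (not_lt.mpr hle)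

/-- **Thm 3.11 for `G` from printed inputs only**: `G` symmetric, `G₀` positive definite, `G₀ = G (1 − R)` and
`‖R‖_{∞→∞} ≤ ρ < 1` (row sums of `|R|`) ⇒ `G` positive definite.  No L² bound on `R` and no bound on `R*` is used.
[folklore] -/
theorem posDef_of_factor_rowSums (G G₀ R : Matrix n n ℝ) (hG : G.IsHermitian) (hG₀ : G₀.PosDef)
    (hfac : G₀ = G * (1 - R)) {ρ : ℝ} (hρ : ρ < 1) (hrow : ∀ i, ∑ j, |R i j| ≤ ρ) : G.PosDef :=
  posDef_of_factor_spectral G G₀ R hG hG₀ hfac fun μ w hw hRw =>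
    lt_of_le_of_lt (le_abs_self μ) (lt_of_le_of_lt (abs_eigenvalue_le_of_row_sums R hrow μ w hw hRw) hρ)

end spectral

end Literature.MathematicalPhysics.QuantumFieldTheory.Balaban1983to89.B9Thm311
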